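import Literature.IUT.HodgeArakelov.MonoThetaProjectiveNaturalSystem
import Literature.IUT.HodgeArakelov.MonoThetaProjectiveBridgeEtThTower
import Literature.AnabelianGeometry.SemiGraphs.TemperedCurveBridge
import Literature.AnabelianGeometry.SemiGraphs.TemperedOpenMapping
import HarnessLib

/-!
# [IUTchII] Prop. 1.5 (i)/(i)′ at the genuine models: the binders `hslimX`, `haugOpen` from the §6 PARAMETERS

S. Mochizuki, *Inter-universal Teichmüller theory II*, §1 Prop. 1.5 (i), kurims p. 29
[claim: Mochizuki2012, status: disputed]; [EtTh] Cor. 2.19 (ii) p. 64 [cite: MochizukiEtTh2009, Cor 2.19(ii) p.64];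
[SemiAnbd] Ex. 3.10 pp. 43–45 ("`Π` … tempered … temp-slim … `1 → π₁^temp(X_K̄) → π₁^temp(X_K) → G_K → 1`")
[cite: MochizukiSemiAnbd2006, Ex 3.10 p.43].

Proof-only companion of abc-iut-w4-d030's `MonoThetaProjectiveBridgeEtThTower.lean` and
`MonoThetaProjectiveNaturalSystem.lean` (nothing there is edited).  Those conditional discharges of
Prop. 1.5 (i)/(i)′ carry two ad-hoc binders on the underlying [EtTh] §1 theta setting `D`:
`hslimX : IsSlimGroup Π^tp_X` and `haugOpen : IsOpenMap (Π^tp_X → G_{ℚ_p})`.  Both are properties of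
`Π^tp_X` recorded by abc-iut-L3's §6 parameter bundle `TemperedCurve.GroupLevelData` (ruling η′: "`Π^temp`
tempered, temp-slim, Galois-countable" — parameters, not facts): `hslimX` is the field `isSlimGroup`, and
`haugOpen` is now a THEOREM from the fields `isTempered` + `secondCountableTopology` by the open mapping
theorem for tempered groups (`TemperedCurve.isOpenMap_aug_of_groupLevelData`, `TemperedOpenMapping.lean`).
The versions below take `d : D.toTemperedCurve.GroupLevelData` instead of the two binders; every other
input (the [EtTh] Cor. 2.18 (iv) level facts, the data `C hC hS … τ f hf`, …) is unchanged.
No side is taken on [IUTchIII] Cor. 3.12; typed ≠ discharged.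
-/

noncomputable section

namespace Literature.IUT.HodgeArakelov

open Literature.AnabelianGeometry.EtaleTheta Literature.AnabelianGeometry.SemiGraphs
open scoped Literature.AnabelianGeometry.EtaleTheta

namespace EtaleLevels

section Tower

variable {p : ℕ} [Fact p.Prime] {D : Literature.AnabelianGeometry.EtaleTheta.ThetaSetting p}
  {E : D.EtaleThetaData} {l : ℕ} (C : E.DoubleUnderline l) (hC : D.Compat) (hS : D.Sec2Hyps)
  (hl : l.Prime) (hp2 : p ≠ 2) (hpl : p ≠ l) (hζ : ∃ ζ : D.K, IsPrimitiveRoot ζ (4 * l))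
  {Es : Set ℕ+} (τ : D.CyclotomeTower l Es)
  (f : contCocycles D.toTheta D.DeltaTheta C.GtpYdduu) (hf : f ∈ C.rootCocycles hC)

/-- **[IUTchII] Prop. 1.5 (i)′ over `ℕ_{≥1}` from a theta setting + cyclotome tower, with `Π^tp_X`
temp-slim / tempered / Galois-countable supplied by the §6 parameter bundle `d`** (no `hslimX`,
`haugOpen` binders): as `prop15_i'_of_cyclotomeTower`. [claim: Mochizuki2012, status: disputed]
(IUTchII §1 Prop 1.5 (i), kurims p.29) [cite: MochizukiEtTh2009, Cor 2.19(ii) p.64] -/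
theorem prop15_i'_of_cyclotomeTower_of_groupLevelData (d : D.toTemperedCurve.GroupLevelData)
    (hsurj : ∀ M : ℕ+, (C.thetaEnvData (τ.modAll M) hC hS).Cor218_iv_surjective)
    (hfibre : ∀ M : ℕ+, (C.thetaEnvData (τ.modAll M) hC hS).Cor218_iv_fibre)
    (A B : MonoThetaProjSystem (modelFamily C hC hS hl hp2 hpl hζ τ.modAll f hf)) :
    Literature.IUT.HodgeArakelov.Prop15_i'
      (reductions C hC hS hl hp2 hpl hζ τ.modAll f hf τ.red_modAll d.isSlimGroup) A B :=
  prop15_i'_of_cyclotomeTower C hC hS hl hp2 hpl hζ τ f hf d.isSlimGroup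
    (D.toTemperedCurve.isOpenMap_aug_of_groupLevelData d) hsurj hfibre A B

/-- **The same, `RigidData` form** (currency of abc-iut-L2-d1's `cor219_ii_model_of_rigid`), with the §6
parameter bundle `d` in place of `hslimX`, `haugOpen`: as `prop15_i'_of_cyclotomeTower_of_rigid`.
[claim: Mochizuki2012, status: disputed] (IUTchII §1 Prop 1.5 (i), kurims p.29)
[cite: MochizukiEtTh2009, Cor 2.18(iv) p.61] -/
theorem prop15_i'_of_cyclotomeTower_of_rigid_of_groupLevelData (d : D.toTemperedCurve.GroupLevelData)
    (h15 : Literature.AnabelianGeometry.EtaleTheta.ThetaSetting.Prop15iii E hC) (L : C.CuspLabels)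
    (hlift : ∀ M : ℕ+, (C.rigidData (τ.modAll M) hC hS h15 L).Cor218_iv_surjective)
    (h214i : ∀ M : ℕ+, (C.rigidData (τ.modAll M) hC hS h15 L).Prop214_i)
    (A B : MonoThetaProjSystem (modelFamily C hC hS hl hp2 hpl hζ τ.modAll f hf)) :
    Literature.IUT.HodgeArakelov.Prop15_i'
      (reductions C hC hS hl hp2 hpl hζ τ.modAll f hf τ.red_modAll d.isSlimGroup) A B :=
  prop15_i'_of_cyclotomeTower_of_rigid C hC hS hl hp2 hpl hζ τ f hf d.isSlimGroup
    (D.toTemperedCurve.isOpenMap_aug_of_groupLevelData d) h15 L hlift h214i A B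

end Tower

section Natural

variable {p : ℕ} [Fact p.Prime] {D : Literature.AnabelianGeometry.EtaleTheta.ThetaSetting p}
  {E : D.EtaleThetaData} {l : ℕ} (C : E.DoubleUnderline l) (hC : D.Compat) (hS : D.Sec2Hyps)
  (hl : l.Prime) (hp2 : p ≠ 2) (hpl : p ≠ l) (hζ : ∃ ζ : D.K, IsPrimitiveRoot ζ (4 * l))
  (mods : ∀ M : ℕ+, D.CyclotomeMod l M)
  (f : contCocycles D.toTheta D.DeltaTheta C.GtpYdduu) (hf : f ∈ C.rootCocycles hC)
  (hmods : ∀ (M M' : ℕ+) (h : (M : ℕ) ∣ (M' : ℕ)) (x : D.lDeltaTheta l),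
    MuN.red p M M' h ((mods M').red x) = (mods M).red x)
  (h15 : Literature.AnabelianGeometry.EtaleTheta.ThetaSetting.Prop15iii E hC) (L : C.CuspLabels)
  (hZ : ∀ M : ℕ+, Nonempty (ModelCyclotomes.lDeltaQuot (C.rigidData (mods M) hC hS h15 L) ≃*
    Literature.IUT.HodgeTheaters.ZHat))

include hmods in
/-- **[EtTh] Cor. 2.19 (ii) in the [IUTchII] encoding — every `IsMonoThetaCompatible` system over the model
family of `X̲̲_K` is isomorphic to the NATURAL one — with `Π^tp_X` temp-slim / tempered / Galois-countable
supplied by the §6 parameter bundle `d`** (no `hslimX`, `haugOpen` binders): as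
`prop15_i_naturalSystem`. [claim: Mochizuki2012, status: disputed] (IUTchII §1 Prop 1.5 (i), kurims p.29)
[cite: MochizukiEtTh2009, Cor 2.19(ii) p.64] -/
theorem prop15_i_naturalSystem_of_groupLevelData (d : D.toTemperedCurve.GroupLevelData)
    (hsurj : ∀ M : ℕ+, (levelData C hC hS mods M).Cor218_iv_surjective)
    (hfibre : ∀ M : ℕ+, (levelData C hC hS mods M).Cor218_iv_fibre)
    (B : MonoThetaProjSystem (modelFamily C hC hS hl hp2 hpl hζ mods f hf))
    (hB : B.IsMonoThetaCompatible (reductions C hC hS hl hp2 hpl hζ mods f hf hmods d.isSlimGroup)) :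
    Prop15_i (naturalSystem C hC hS hl hp2 hpl hζ mods f hf hmods h15 L hZ) B :=
  prop15_i_naturalSystem C hC hS hl hp2 hpl hζ mods f hf hmods h15 L hZ d.isSlimGroup
    (D.toTemperedCurve.isOpenMap_aug_of_groupLevelData d) hsurj hfibre B hB

end Natural

end EtaleLevels

end Literature.IUT.HodgeArakelov

end
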